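import Summits.CriticalPhenomena.PercolationContinuityZ3.Theorems.PercNearOneGluingAdditiveGluingKnThm2Refined
import Summits.CriticalPhenomena.PercolationContinuityZ3.Theorems.PercNearOneGluingAdditiveGluingKnThm2Good
import HarnessLib

/-!
# `NoHeavyLowerTail` (stmt-CriticalPhenomena-4575) — three-relay EVENT GLUING EG₃ (sharp constant 1) from the
# Kozma–Nitzan six-BHK RESIDUAL row (new-inequality factory, claim rows RES_A = (KNS)₃ / SD1 / KN-EG and their refined form)

Support file (prover `prim-ineq-prove-4`, factory PROOF seat; `--supports stmt-CriticalPhenomena-4575`).  No definitions, no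
named facts, no sorries.

Setting: `μ = prodBernoulli w` on `Fin n`, observer `o`, sink `b`, three distinct relays `a₁, a₂, a₃`, `a₃` the DESIGNATED relay
(the factory uses the worst one, `μ(a₃ ↔ b)` minimal, but no minimality is needed below).  EG₃ at `a₃` is
`μ({o ↔ A} ∖ {o ↔ b}) ≤ μ(a₃ ↮ b)`; its slack equals `X + Z` with Kozma–Nitzan's `X = μ(o↔A, o↔b) − μ(o↔A, a₃↔b) = I + II + III`
(arXiv:2401.12397 Thm. 2, tree `stub_knThm2GoodSplit`) and `Z = μ(o ↮ A, a₃ ↮ b)`.  The six van den Berg–Häggström–Kahn steps of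
KN's proof (tree `knThm2_bhkOne/Two`, source sets `O ∈ {{a₁,a₂},{a₁},{a₂}}` conditioned on `N_O = {O ↮ A ∖ O}`) give
`P₁ P₂ P₁₂ · X ≥ P₁ P₂ · A₁₂ (m₁₂ − m₃) + P₂ P₁₂ · A₁ (m₁ − m₂₃) + P₁ P₁₂ · A₂ (m₂ − m₁₃)`, hence

* `eg3_of_knResidual`:  if the RESIDUAL ROW
  `P₁ P₂ · A₁₂ (m₁₂ − m₃) + P₂ P₁₂ · A₁ (m₁ − m₂₃) + P₁ P₁₂ · A₂ (m₂ − m₁₃) + P₁ P₂ P₁₂ · μ(o ↮ A, a₃ ↮ b) ≥ 0`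
  holds on the graph, then EG₃ holds at `a₃`.  In conditional notation the row is the factory's
  `(KNS)₃ = RES_A`:  `φ(12)(m₁₂ − m₃) + φ(1)(m₁ − m₂₃) + φ(2)(m₂ − m₁₃) + μ(o↮A, a₃↮b) ≥ 0` (`φ(O) = A_O / P_O`), found independently by
  the seats prim-ineq-gen-6 (RES / Φ_RES), prim-ineq-gen-7 (SD1) and prim-ineq-prove-4 (KN-EG) on 2026-08-19; it has 0 violations on all
  94,659 worst-first instances of the wf3lp realizable dumps and in adversarial searches, and its conjectured validity (for `a₃` worst) would
  give EG₃ with the sharp constant in every regime.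
* `eg3_of_refinedResidual`: the same with the REFINED steps of `knThm2_refined` (source sets `O ∪ {o}`, conditioning
  `N'_O = {O ∪ {o} ↮ A ∖ O}`), a weaker hypothesis (numerically the refined bound captures ≥ 0.65 of the EG₃ slack where the plain one
  captures 0.05).
Both are pure bookkeeping on landed tools (`stub_bhkSets`, `stub_knThm2GoodSplit`, `knThm2_bhkOne/Two`, `knRef_bhkOne/Two`).
-/

namespace Summit.CriticalPhenomena.PercolationContinuityZ3.Theorems

open MeasureTheory Set Literature.Probability.LatticeModels Literature.Probability.Percolation

noncomputable section
open Classical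

variable {n : ℕ}

namespace EG3Residual

/-- Real-arithmetic core: from the six BHK bounds `A₁₂ m₁₂ ≤ P₁₂ T₁₂`, `P₁₂ U₁₂ ≤ A₁₂ m₃`, `A₁ m₁ ≤ P₁ T₁`, `P₁ U₁ ≤ A₁ m₂₃`,
`A₂ m₂ ≤ P₂ T₂`, `P₂ U₂ ≤ A₂ m₁₃` (with `P₁, P₂, P₁₂ > 0`) and the residual row
`P₁ P₂ · A₁₂ (m₁₂ − m₃) + P₂ P₁₂ · A₁ (m₁ − m₂₃) + P₁ P₁₂ · A₂ (m₂ − m₁₃) + P₁ P₂ P₁₂ · Z ≥ 0`: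
`(T₁₂ − U₁₂) + (T₁ − U₁) + (T₂ − U₂) + Z ≥ 0`. [folklore] -/
theorem arith {T₁₂ U₁₂ T₁ U₁ T₂ U₂ P₁₂ P₁ P₂ A₁₂ A₁ A₂ m₁₂ m₃ m₁ m₂₃ m₂ m₁₃ Z : ℝ}
    (hP₁₂ : 0 < P₁₂) (hP₁ : 0 < P₁) (hP₂ : 0 < P₂)
    (h1 : A₁₂ * m₁₂ ≤ P₁₂ * T₁₂) (h2 : P₁₂ * U₁₂ ≤ A₁₂ * m₃)
    (h3 : A₁ * m₁ ≤ P₁ * T₁) (h4 : P₁ * U₁ ≤ A₁ * m₂₃)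
    (h5 : A₂ * m₂ ≤ P₂ * T₂) (h6 : P₂ * U₂ ≤ A₂ * m₁₃)
    (hres : 0 ≤ P₁ * P₂ * (A₁₂ * (m₁₂ - m₃)) + P₂ * P₁₂ * (A₁ * (m₁ - m₂₃)) + P₁ * P₁₂ * (A₂ * (m₂ - m₁₃))
      + P₁ * P₂ * P₁₂ * Z) :
    0 ≤ (T₁₂ - U₁₂) + (T₁ - U₁) + (T₂ - U₂) + Z := by
  have ha : A₁₂ * (m₁₂ - m₃) ≤ P₁₂ * (T₁₂ - U₁₂) := by linarith
  have hb : A₁ * (m₁ - m₂₃) ≤ P₁ * (T₁ - U₁) := by linarith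
  have hc : A₂ * (m₂ - m₁₃) ≤ P₂ * (T₂ - U₂) := by linarith
  have ha' : P₁ * P₂ * (A₁₂ * (m₁₂ - m₃)) ≤ P₁ * P₂ * (P₁₂ * (T₁₂ - U₁₂)) :=
    mul_le_mul_of_nonneg_left ha (mul_nonneg hP₁.le hP₂.le)
  have hb' : P₂ * P₁₂ * (A₁ * (m₁ - m₂₃)) ≤ P₂ * P₁₂ * (P₁ * (T₁ - U₁)) :=
    mul_le_mul_of_nonneg_left hb (mul_nonneg hP₂.le hP₁₂.le)
  have hc' : P₁ * P₁₂ * (A₂ * (m₂ - m₁₃)) ≤ P₁ * P₁₂ * (P₂ * (T₂ - U₂)) :=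
    mul_le_mul_of_nonneg_left hc (mul_nonneg hP₁.le hP₁₂.le)
  have hid : P₁ * P₂ * (P₁₂ * (T₁₂ - U₁₂)) + P₂ * P₁₂ * (P₁ * (T₁ - U₁)) + P₁ * P₁₂ * (P₂ * (T₂ - U₂))
      + P₁ * P₂ * P₁₂ * Z = (P₁ * P₂ * P₁₂) * ((T₁₂ - U₁₂) + (T₁ - U₁) + (T₂ - U₂) + Z) := by ring
  have hprod : 0 < P₁ * P₂ * P₁₂ := mul_pos (mul_pos hP₁ hP₂) hP₁₂
  have hge : 0 ≤ (P₁ * P₂ * P₁₂) * ((T₁₂ - U₁₂) + (T₁ - U₁) + (T₂ - U₂) + Z) := by linarith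
  by_contra hneg
  push Not at hneg
  have := mul_neg_of_pos_of_neg hprod hneg
  linarith

/-- Measure bookkeeping: `X + Z ≥ 0`, i.e. `μ(o↔A, a₃↔b) ≤ μ(o↔A, o↔b) + μ(o↮A, a₃↮b)`, is exactly EG₃ at `a₃`:
`μ({o↔A} ∖ {o↔b}) ≤ μ(a₃ ↮ b)`. [folklore] -/
theorem eg3_of_XZ (w : Sym2 (Fin n) → unitInterval) (o b a₃ : Fin n) (E : Set (BondConfig (Fin n)))
    (h : (prodBernoulli w).real (E ∩ openConn a₃ b) ≤
      (prodBernoulli w).real (E ∩ openConn o b) + (prodBernoulli w).real (Eᶜ ∩ (openConn a₃ b)ᶜ)) :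
    (prodBernoulli w).real (E \ openConn o b) ≤ (prodBernoulli w).real ((openConn a₃ b)ᶜ : Set (BondConfig (Fin n))) := by
  have hm : ∀ s : Set (BondConfig (Fin n)), MeasurableSet s := fun _ => MeasurableSet.of_discrete
  have h1 := measureReal_inter_add_sdiff (μ := prodBernoulli w) (s := E) (hm (openConn o b))
  have h2 := measureReal_inter_add_sdiff (μ := prodBernoulli w) (s := E) (hm (openConn a₃ b))
  have h3 := measureReal_inter_add_sdiff (μ := prodBernoulli w) (s := ((openConn a₃ b)ᶜ : Set (BondConfig (Fin n)))) (hm E)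
  have e1 : ((openConn a₃ b)ᶜ : Set (BondConfig (Fin n))) ∩ E = E \ openConn a₃ b := by
    ext ω; simp only [mem_inter_iff, mem_compl_iff, mem_sdiff]; tauto
  have e2 : ((openConn a₃ b)ᶜ : Set (BondConfig (Fin n))) \ E = Eᶜ ∩ (openConn a₃ b)ᶜ := by
    ext ω; simp only [mem_inter_iff, mem_compl_iff, mem_sdiff]; tauto
  rw [e1, e2] at h3
  linarith

end EG3Residual

open EG3Residual

/-- **EG₃ from the Kozma–Nitzan residual row (plain conditioning).**  With `N₁₂ = {a₁↮a₃} ∩ {a₂↮a₃}`,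
`N₁ = {a₁↮a₂} ∩ {a₁↮a₃}`, `N₂ = {a₂↮a₁} ∩ {a₂↮a₃}`, `P_O = μ(N_O)`, `A₁₂ = μ(N₁₂ ∩ {a₁↔o ∨ a₂↔o})`, `A₁ = μ(N₁ ∩ {a₁↔o})`,
`A₂ = μ(N₂ ∩ {a₂↔o})`, `m_T` the masses `μ(N_O ∩ {b ↔ all of T})`, and `Z = μ(o ↮ A, a₃ ↮ b)`:  if `P₁, P₂, P₁₂ > 0` and
`P₁ P₂ · A₁₂ (m₁₂ − m₃) + P₂ P₁₂ · A₁ (m₁ − m₂₃) + P₁ P₁₂ · A₂ (m₂ − m₁₃) + P₁ P₂ P₁₂ · Z ≥ 0` (the factory row RES_A = (KNS)₃ with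
denominators cleared), then `μ({o↔A} ∖ {o↔b}) ≤ μ(a₃ ↮ b)`.  Proof: `X = I + II + III` (`stub_knThm2GoodSplit`), the six set-BHK steps
(`knThm2_bhkOne/Two` fed with the landed `stub_bhkSets`), `EG3Residual.arith`, `EG3Residual.eg3_of_XZ`.
[cite: KozmaNitzan2024, Theorem 2 (§3.2, pp. 8–9); VandenbergHaggstromKahn2005, Thms. 1.3–1.4 (pp. 6–7)] -/
theorem eg3_of_knResidual (w : Sym2 (Fin n) → unitInterval) (o b a₁ a₂ a₃ : Fin n)
    (h12 : a₁ ≠ a₂) (h13 : a₁ ≠ a₃) (h23 : a₂ ≠ a₃)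
    (hP₁₂ : 0 < (prodBernoulli w).real ((openConn a₁ a₃)ᶜ ∩ (openConn a₂ a₃)ᶜ : Set (BondConfig (Fin n))))
    (hP₁ : 0 < (prodBernoulli w).real ((openConn a₁ a₂)ᶜ ∩ (openConn a₁ a₃)ᶜ : Set (BondConfig (Fin n))))
    (hP₂ : 0 < (prodBernoulli w).real ((openConn a₂ a₁)ᶜ ∩ (openConn a₂ a₃)ᶜ : Set (BondConfig (Fin n))))
    (hres : 0 ≤
        (prodBernoulli w).real ((openConn a₁ a₂)ᶜ ∩ (openConn a₁ a₃)ᶜ : Set (BondConfig (Fin n)))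
          * (prodBernoulli w).real ((openConn a₂ a₁)ᶜ ∩ (openConn a₂ a₃)ᶜ : Set (BondConfig (Fin n)))
          * ((prodBernoulli w).real ((openConn a₁ a₃)ᶜ ∩ (openConn a₂ a₃)ᶜ ∩ (openConn a₁ o ∪ openConn a₂ o))
            * ((prodBernoulli w).real ((openConn a₁ a₃)ᶜ ∩ (openConn a₂ a₃)ᶜ ∩ (openConn a₁ b ∩ openConn a₂ b))
              - (prodBernoulli w).real ((openConn a₁ a₃)ᶜ ∩ (openConn a₂ a₃)ᶜ ∩ openConn a₃ b)))
      + (prodBernoulli w).real ((openConn a₂ a₁)ᶜ ∩ (openConn a₂ a₃)ᶜ : Set (BondConfig (Fin n)))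
          * (prodBernoulli w).real ((openConn a₁ a₃)ᶜ ∩ (openConn a₂ a₃)ᶜ : Set (BondConfig (Fin n)))
          * ((prodBernoulli w).real ((openConn a₁ a₂)ᶜ ∩ (openConn a₁ a₃)ᶜ ∩ openConn a₁ o)
            * ((prodBernoulli w).real ((openConn a₁ a₂)ᶜ ∩ (openConn a₁ a₃)ᶜ ∩ openConn a₁ b)
              - (prodBernoulli w).real ((openConn a₁ a₂)ᶜ ∩ (openConn a₁ a₃)ᶜ ∩ (openConn a₂ b ∩ openConn a₃ b))))
      + (prodBernoulli w).real ((openConn a₁ a₂)ᶜ ∩ (openConn a₁ a₃)ᶜ : Set (BondConfig (Fin n)))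
          * (prodBernoulli w).real ((openConn a₁ a₃)ᶜ ∩ (openConn a₂ a₃)ᶜ : Set (BondConfig (Fin n)))
          * ((prodBernoulli w).real ((openConn a₂ a₁)ᶜ ∩ (openConn a₂ a₃)ᶜ ∩ openConn a₂ o)
            * ((prodBernoulli w).real ((openConn a₂ a₁)ᶜ ∩ (openConn a₂ a₃)ᶜ ∩ openConn a₂ b)
              - (prodBernoulli w).real ((openConn a₂ a₁)ᶜ ∩ (openConn a₂ a₃)ᶜ ∩ (openConn a₁ b ∩ openConn a₃ b))))
      + (prodBernoulli w).real ((openConn a₁ a₂)ᶜ ∩ (openConn a₁ a₃)ᶜ : Set (BondConfig (Fin n)))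
          * (prodBernoulli w).real ((openConn a₂ a₁)ᶜ ∩ (openConn a₂ a₃)ᶜ : Set (BondConfig (Fin n)))
          * (prodBernoulli w).real ((openConn a₁ a₃)ᶜ ∩ (openConn a₂ a₃)ᶜ : Set (BondConfig (Fin n)))
          * (prodBernoulli w).real ((openConn o a₁ ∪ openConn o a₂ ∪ openConn o a₃)ᶜ ∩ (openConn a₃ b)ᶜ)) :
    (prodBernoulli w).real ((openConn o a₁ ∪ openConn o a₂ ∪ openConn o a₃) \ openConn o b) ≤
      (prodBernoulli w).real ((openConn a₃ b)ᶜ : Set (BondConfig (Fin n))) := by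
  -- the six set-BHK bounds (KN p. 9), tools = the landed `stub_bhkSets`
  have i1 := knThm2_bhkOne stub_bhkSets.1 w {a₁, a₂} ({a₃} : Set (Fin n)) o b (by simp [h13, h23])
  have i2 := knThm2_bhkTwo stub_bhkSets.2 w {a₁, a₂} {a₃} o b (by simp [h13.symm, h23.symm])
  have i3 := knThm2_bhkOne stub_bhkSets.1 w {a₁} ({a₂, a₃} : Set (Fin n)) o b (by simp [h12, h13])
  have i4 := knThm2_bhkTwo stub_bhkSets.2 w {a₁} {a₂, a₃} o b (by simp [h12, h13])
  have i5 := knThm2_bhkOne stub_bhkSets.1 w {a₂} ({a₁, a₃} : Set (Fin n)) o b (by simp [h12.symm, h23])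
  have i6 := knThm2_bhkTwo stub_bhkSets.2 w {a₂} {a₁, a₃} o b (by simp [h12.symm, h23])
  rw [knThm2_sep_pair_set, Finset.set_biUnion_insert, Finset.set_biUnion_singleton,
    Finset.set_biInter_insert, Finset.set_biInter_singleton] at i1
  rw [knThm2_sep_pair_finset, Finset.set_biUnion_insert, Finset.set_biUnion_singleton,
    Finset.set_biInter_singleton] at i2
  rw [knThm2_sep_single_set, Finset.set_biUnion_singleton, Finset.set_biInter_singleton] at i3
  rw [knThm2_sep_single_finset, Finset.set_biUnion_singleton, Finset.set_biInter_insert,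
    Finset.set_biInter_singleton] at i4
  rw [knThm2_sep_single_set, Finset.set_biUnion_singleton, Finset.set_biInter_singleton] at i5
  rw [knThm2_sep_single_finset, Finset.set_biUnion_singleton, Finset.set_biInter_insert,
    Finset.set_biInter_singleton] at i6
  -- `X = I + II + III`
  have hsplit := stub_knThm2GoodSplit n w o b a₁ a₂ a₃
  have key := arith hP₁₂ hP₁ hP₂ i1 i2 i3 i4 i5 i6 hres
  apply eg3_of_XZ
  linarith

/-- **EG₃ from the REFINED residual row** (source sets `O ∪ {o}`; conditioning `N'₁₂ = {a₁↮a₃} ∩ {a₂↮a₃} ∩ {o↮a₃}`,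
`N'₁ = {a₁↮a₂} ∩ {a₁↮a₃} ∩ {o↮a₂} ∩ {o↮a₃}`, `N'₂` symmetric, `P'_O = μ(N'_O)`, `A_O` and `m'_T` as in `knThm2_refined`):
if `P'₁, P'₂, P'₁₂ > 0` and
`P'₁ P'₂ · A₁₂ (m'₁₂ − m'₃) + P'₂ P'₁₂ · A₁ (m'₁ − m'₂₃) + P'₁ P'₁₂ · A₂ (m''₂ − m''₁₃) + P'₁ P'₂ P'₁₂ · μ(o↮A, a₃↮b) ≥ 0`,
then `μ({o↔A} ∖ {o↔b}) ≤ μ(a₃ ↮ b)`.  Each refined step is at least as strong as the plain one, so this hypothesis is weaker than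
that of `eg3_of_knResidual`.  Proof: as `knThm2_refined` (`knRef_bhkOne/Two`, `knRef_absorb12/1`, `stub_knThm2GoodSplit`) with
`EG3Residual.arith` and `EG3Residual.eg3_of_XZ`.
[cite: KozmaNitzan2024, Theorem 2 (§3.2, pp. 8–9); VandenbergHaggstromKahn2005, Thms. 1.3–1.4 (pp. 6–7)] -/
theorem eg3_of_refinedResidual (w : Sym2 (Fin n) → unitInterval) (o b a₁ a₂ a₃ : Fin n)
    (h12 : a₁ ≠ a₂) (h13 : a₁ ≠ a₃) (h23 : a₂ ≠ a₃) (ho1 : o ≠ a₁) (ho2 : o ≠ a₂) (ho3 : o ≠ a₃)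
    (hP₁₂ : 0 < (prodBernoulli w).real
      ((openConn a₁ a₃)ᶜ ∩ (openConn a₂ a₃)ᶜ ∩ (openConn o a₃)ᶜ : Set (BondConfig (Fin n))))
    (hP₁ : 0 < (prodBernoulli w).real
      ((openConn a₁ a₂)ᶜ ∩ (openConn a₁ a₃)ᶜ ∩ ((openConn o a₂)ᶜ ∩ (openConn o a₃)ᶜ) : Set (BondConfig (Fin n))))
    (hP₂ : 0 < (prodBernoulli w).real
      ((openConn a₂ a₁)ᶜ ∩ (openConn a₂ a₃)ᶜ ∩ ((openConn o a₁)ᶜ ∩ (openConn o a₃)ᶜ) : Set (BondConfig (Fin n))))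
    (hres : 0 ≤
        (prodBernoulli w).real ((openConn a₁ a₂)ᶜ ∩ (openConn a₁ a₃)ᶜ ∩ ((openConn o a₂)ᶜ ∩ (openConn o a₃)ᶜ) : Set (BondConfig (Fin n)))
          * (prodBernoulli w).real ((openConn a₂ a₁)ᶜ ∩ (openConn a₂ a₃)ᶜ ∩ ((openConn o a₁)ᶜ ∩ (openConn o a₃)ᶜ) : Set (BondConfig (Fin n)))
          * ((prodBernoulli w).real ((openConn a₁ a₃)ᶜ ∩ (openConn a₂ a₃)ᶜ ∩ (openConn o a₃)ᶜ ∩ (openConn a₁ o ∪ openConn a₂ o))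
            * ((prodBernoulli w).real ((openConn a₁ a₃)ᶜ ∩ (openConn a₂ a₃)ᶜ ∩ (openConn o a₃)ᶜ ∩ (openConn a₁ b ∩ openConn a₂ b))
              - (prodBernoulli w).real ((openConn a₁ a₃)ᶜ ∩ (openConn a₂ a₃)ᶜ ∩ (openConn o a₃)ᶜ ∩ openConn a₃ b)))
      + (prodBernoulli w).real ((openConn a₂ a₁)ᶜ ∩ (openConn a₂ a₃)ᶜ ∩ ((openConn o a₁)ᶜ ∩ (openConn o a₃)ᶜ) : Set (BondConfig (Fin n)))
          * (prodBernoulli w).real ((openConn a₁ a₃)ᶜ ∩ (openConn a₂ a₃)ᶜ ∩ (openConn o a₃)ᶜ : Set (BondConfig (Fin n)))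
          * ((prodBernoulli w).real ((openConn a₁ a₂)ᶜ ∩ (openConn a₁ a₃)ᶜ ∩ ((openConn o a₂)ᶜ ∩ (openConn o a₃)ᶜ) ∩ openConn a₁ o)
            * ((prodBernoulli w).real ((openConn a₁ a₂)ᶜ ∩ (openConn a₁ a₃)ᶜ ∩ ((openConn o a₂)ᶜ ∩ (openConn o a₃)ᶜ) ∩ openConn a₁ b)
              - (prodBernoulli w).real ((openConn a₁ a₂)ᶜ ∩ (openConn a₁ a₃)ᶜ ∩ ((openConn o a₂)ᶜ ∩ (openConn o a₃)ᶜ) ∩ (openConn a₂ b ∩ openConn a₃ b))))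
      + (prodBernoulli w).real ((openConn a₁ a₂)ᶜ ∩ (openConn a₁ a₃)ᶜ ∩ ((openConn o a₂)ᶜ ∩ (openConn o a₃)ᶜ) : Set (BondConfig (Fin n)))
          * (prodBernoulli w).real ((openConn a₁ a₃)ᶜ ∩ (openConn a₂ a₃)ᶜ ∩ (openConn o a₃)ᶜ : Set (BondConfig (Fin n)))
          * ((prodBernoulli w).real ((openConn a₂ a₁)ᶜ ∩ (openConn a₂ a₃)ᶜ ∩ ((openConn o a₁)ᶜ ∩ (openConn o a₃)ᶜ) ∩ openConn a₂ o)
            * ((prodBernoulli w).real ((openConn a₂ a₁)ᶜ ∩ (openConn a₂ a₃)ᶜ ∩ ((openConn o a₁)ᶜ ∩ (openConn o a₃)ᶜ) ∩ openConn a₂ b)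
              - (prodBernoulli w).real ((openConn a₂ a₁)ᶜ ∩ (openConn a₂ a₃)ᶜ ∩ ((openConn o a₁)ᶜ ∩ (openConn o a₃)ᶜ) ∩ (openConn a₁ b ∩ openConn a₃ b))))
      + (prodBernoulli w).real ((openConn a₁ a₂)ᶜ ∩ (openConn a₁ a₃)ᶜ ∩ ((openConn o a₂)ᶜ ∩ (openConn o a₃)ᶜ) : Set (BondConfig (Fin n)))
          * (prodBernoulli w).real ((openConn a₂ a₁)ᶜ ∩ (openConn a₂ a₃)ᶜ ∩ ((openConn o a₁)ᶜ ∩ (openConn o a₃)ᶜ) : Set (BondConfig (Fin n)))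
          * (prodBernoulli w).real ((openConn a₁ a₃)ᶜ ∩ (openConn a₂ a₃)ᶜ ∩ (openConn o a₃)ᶜ : Set (BondConfig (Fin n)))
          * (prodBernoulli w).real ((openConn o a₁ ∪ openConn o a₂ ∪ openConn o a₃)ᶜ ∩ (openConn a₃ b)ᶜ)) :
    (prodBernoulli w).real ((openConn o a₁ ∪ openConn o a₂ ∪ openConn o a₃) \ openConn o b) ≤
      (prodBernoulli w).real ((openConn a₃ b)ᶜ : Set (BondConfig (Fin n))) := by
  have hs12 : ({a₁, a₂} : Finset (Fin n)) ⊆ {a₁, a₂, o} := by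
    intro x hx; simp only [Finset.mem_insert, Finset.mem_singleton] at hx ⊢; tauto
  have hs1 : ({a₁} : Finset (Fin n)) ⊆ {a₁, o} := by
    intro x hx; simp only [Finset.mem_insert, Finset.mem_singleton] at hx ⊢; tauto
  have hs2 : ({a₂} : Finset (Fin n)) ⊆ {a₂, o} := by
    intro x hx; simp only [Finset.mem_insert, Finset.mem_singleton] at hx ⊢; tauto
  have i1 := knRef_bhkOne stub_bhkSets.1 w {a₁, a₂, o} {a₁, a₂} hs12 ({a₃} : Set (Fin n)) o b
    (by simp [h13, h23, ho3])
  have i2 := knRef_bhkTwo stub_bhkSets.2 w {a₁, a₂, o} {a₃} {a₁, a₂} {a₃} hs12 subset_rfl o b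
    (by simp [h13.symm, h23.symm, ho3.symm])
  have i3 := knRef_bhkOne stub_bhkSets.1 w {a₁, o} {a₁} hs1 ({a₂, a₃} : Set (Fin n)) o b
    (by simp [h12, h13, ho2, ho3])
  have i4 := knRef_bhkTwo stub_bhkSets.2 w {a₁, o} {a₂, a₃} {a₁} {a₂, a₃} hs1 subset_rfl o b
    (by simp [h12.symm, h13.symm, ho2.symm, ho3.symm])
  have i5 := knRef_bhkOne stub_bhkSets.1 w {a₂, o} {a₂} hs2 ({a₁, a₃} : Set (Fin n)) o b
    (by simp [h12.symm, h23, ho1, ho3])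
  have i6 := knRef_bhkTwo stub_bhkSets.2 w {a₂, o} {a₁, a₃} {a₂} {a₁, a₃} hs2 subset_rfl o b
    (by simp [h12, h23.symm, ho1.symm, ho3.symm])
  rw [knRef_sep3_set, Finset.set_biUnion_insert, Finset.set_biUnion_singleton,
    Finset.set_biInter_insert, Finset.set_biInter_singleton] at i1
  rw [knRef_sep3_finset, Finset.set_biUnion_insert, Finset.set_biUnion_singleton,
    Finset.set_biInter_singleton] at i2
  rw [knRef_sep2_set, Finset.set_biUnion_singleton, Finset.set_biInter_singleton] at i3
  rw [knRef_sep2_finset, Finset.set_biUnion_singleton, Finset.set_biInter_insert,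
    Finset.set_biInter_singleton] at i4
  rw [knRef_sep2_set, Finset.set_biUnion_singleton, Finset.set_biInter_singleton] at i5
  rw [knRef_sep2_finset, Finset.set_biUnion_singleton, Finset.set_biInter_insert,
    Finset.set_biInter_singleton] at i6
  have hsplit := stub_knThm2GoodSplit n w o b a₁ a₂ a₃
  rw [knRef_absorb12 o a₁ a₂ a₃ (openConn a₁ b ∩ openConn a₂ b), knRef_absorb12 o a₁ a₂ a₃ (openConn a₃ b),
    knRef_absorb1 o a₁ a₂ a₃ (openConn a₁ b), knRef_absorb1 o a₁ a₂ a₃ (openConn a₂ b ∩ openConn a₃ b),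
    knRef_absorb1 o a₂ a₁ a₃ (openConn a₂ b), knRef_absorb1 o a₂ a₁ a₃ (openConn a₁ b ∩ openConn a₃ b)] at hsplit
  have key := arith hP₁₂ hP₁ hP₂ i1 i2 i3 i4 i5 i6 hres
  apply eg3_of_XZ
  linarith

end

end Summit.CriticalPhenomena.PercolationContinuityZ3.Theorems
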